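import Literature.NumberTheory.LFunctions.VinogradovMeanValueCount
import HarnessLib

/-!
# The statement of Ford's Lemma 3.4 (the step `J_{s,k} → J_{s+k,k}` of Vinogradov's method)

Topic `Literature/NumberTheory/LFunctions`. Everything here is a DEFINITION (Ford's `φ_J`, `Δ'`, `V`
of Lemma 3.4, the exponent of Lemma 3.5, and the *statement* `FordP1.Lemma34Hyp k ω` of Lemma 3.4
at `(k, ω)` for `s = nk`) plus elementary identities; no named fact is introduced and nothing is
asserted: `Lemma34Hyp` is used downstream ONLY AS A HYPOTHESIS (`FordProgram1.lean`,
`FordTheorem3SmallK.lean`: the second part of Theorem 3 for `129 ≤ k ≤ 1190`; the closed-form rows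
for `k ≥ 1191`), pending the tree's formalisation of the lemma itself (Ford's iteration of his
Lemmas 3.2–3.3 with the prime windows of `FordPrimeWindowsPNT.lean`).

K. Ford, Proc. LMS 85 (2002), Lemma 3.4: *Suppose `k ≥ 26`, `4 ≤ r ≤ k`, `k ≤ s ≤ k³` and
`J_{s,k}(Q) ≤ C Q^{2s − k(k+1)/2 + Δ}` (`Q ≥ 1`). Let `j` be an integer with `2 ≤ j ≤ 9r/10`,
`(j−1)(j−2) ≤ 2Δ − (k−r)(k−r+1)` ((3.8)). Define `φ_j = 1/r`,
`φ_J = 1/(2r) + (k² + k + r² − r + J² − J − 2Δ) φ_{J+1}/(4kr)` (`1 ≤ J ≤ j−1`), and suppose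
`φ_i ≥ 1/(k+1)` for every `i`. Suppose `1/(3 log k) ≤ ω ≤ 1/2`, `η = 1 + ω`,
`V = max(e^{1.5+1.5/ω}, (18/ω)k³ log k)`. If `P ≥ V^{k+1}` then
`J_{s+k,k}(P) ≤ k^{3k} η^{4s+k²} C P^{2(s+k) − k(k+1)/2 + Δ'}`,
`Δ' = Δ(1 − φ₁) − k + ½φ₁(k² + k + r² − r)`.*  Here `s = nk` (the only case used by Lemma 3.5), the
condition on `ω` is kept outside the predicate, and `k ≥ 26` is a property of the numeral `k` at
which the predicate is instantiated.

## References

* K. Ford, Proc. London Math. Soc. (3) 85 (2002), 565–633; arXiv:1910.08209: Lemma 3.4, Lemma 3.5,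
  (3.8). [Ford2002]
-/

namespace Literature.NumberTheory.LFunctions
namespace FordP1

open Finset Real

/-- Ford's `φ_J` (Lemma 3.4), indexed downwards: `phiDown k r Δ j m = φ_{j−m}`, i.e. `φ_j = 1/r` and
`φ_J = 1/(2r) + (k² + k + r² − r + J² − J − 2Δ) φ_{J+1} / (4kr)`. [cite: Ford2002, Lemma 3.4] -/
noncomputable def phiDown (k r Δ : ℝ) (j : ℕ) : ℕ → ℝ
  | 0 => 1 / r
  | m + 1 => 1 / (2 * r) +
      (k ^ 2 + k + r ^ 2 - r + ((j - (m + 1) : ℕ) : ℝ) ^ 2 - ((j - (m + 1) : ℕ) : ℝ) - 2 * Δ) / (4 * k * r) *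
        phiDown k r Δ j m

/-- Ford's `φ_J = φ_J(k, r, Δ; j)` for `1 ≤ J ≤ j`. [cite: Ford2002, Lemma 3.4] -/
noncomputable def phiF (k r Δ : ℝ) (j J : ℕ) : ℝ := phiDown k r Δ j (j - J)

/-- Ford's `Δ' = Δ(1 − φ₁) − k + ½φ₁(k² + k + r² − r)` of Lemma 3.4 (so that
`δ₀(k,r,Δ) = dnext k r Δ j` with `j` maximal in (3.8)). [cite: Ford2002, Lemma 3.4] -/
noncomputable def dnext (k r Δ : ℝ) (j : ℕ) : ℝ :=
  Δ * (1 - phiF k r Δ j 1) - k + phiF k r Δ j 1 / 2 * (k ^ 2 + k + r ^ 2 - r)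

/-- Ford's `V = max(e^{1.5 + 1.5/ω}, (18/ω) k³ log k)` of Lemma 3.4. [cite: Ford2002, Lemma 3.4] -/
noncomputable def Vf (k : ℕ) (ω : ℝ) : ℝ :=
  max (Real.exp (3 / 2 + 3 / (2 * ω))) (18 / ω * (k : ℝ) ^ 3 * Real.log k)

/-- `φ_j = 1/r`. [cite: Ford2002, Lemma 3.4] -/
theorem phiF_self (k r Δ : ℝ) (j : ℕ) : phiF k r Δ j j = 1 / r := by
  simp [phiF, phiDown]

/-- The recursion in `y`-form: `φ_J = 1/(2r) + (2kr + J² − J − y) φ_{J+1}/(4kr)`,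
`y = 2Δ − (k−r)(k−r+1)`. [cite: Ford2002, Lemma 3.4 and proof of Lemma 3.5] -/
theorem phiF_rec (k r Δ : ℝ) (j : ℕ) {J : ℕ} (hJ1 : 1 ≤ J) (hJ : J < j) :
    phiF k r Δ j J = 1 / (2 * r) +
      (2 * k * r + (J : ℝ) ^ 2 - J - (2 * Δ - (k - r) * (k - r + 1))) / (4 * k * r) * phiF k r Δ j (J + 1) := by
  have e1 : j - J = (j - (J + 1)) + 1 := by omega
  have e2 : j - (j - (J + 1) + 1) = J := by omega
  rw [phiF, phiF, e1, phiDown, e2]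
  ring

/-- `Δ' = Δ − k + ½ φ₁ (2kr − y)`. [cite: Ford2002, proof of Lemma 3.6 ((3.16))] -/
theorem dnext_eq (k r Δ : ℝ) (j : ℕ) :
    dnext k r Δ j = Δ - k + phiF k r Δ j 1 / 2 * (2 * k * r - (2 * Δ - (k - r) * (k - r + 1))) := by
  unfold dnext; ring

/-- The exponent `2(nk) − k(k+1)/2 + Δ`. [cite: Ford2002, Lemma 3.5] -/
noncomputable def expo (k n : ℕ) (Δ : ℝ) : ℝ :=
  2 * ((n * k : ℕ) : ℝ) - ((k * (k + 1) / 2 : ℕ) : ℝ) + Δ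

/-- **The statement of Ford's Lemma 3.4 at `(k, ω)` for `s = nk`**, used below ONLY AS A HYPOTHESIS
(it is not asserted in this file): if `4 ≤ r ≤ k`, `k ≤ s = nk ≤ k³`,
`J_{s,k}(Q) ≤ C Q^{2s − k(k+1)/2 + Δ}` (`Q ≥ 1`), `j` satisfies (3.8) and `φ_i ≥ 1/(k+1)` for all
`i`, then for `P ≥ V^{k+1}` (`η = 1 + ω`, `V = max(e^{1.5+1.5/ω}, (18/ω)k³ log k)`)
`J_{s+k,k}(P) ≤ k^{3k} η^{4s+k²} C P^{2(s+k) − k(k+1)/2 + Δ'}`. The side condition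
`1/(3 log k) ≤ ω ≤ 1/2` of the lemma is kept outside (see `row_of_checkK`). [cite: Ford2002, Lemma 3.4] -/
def Lemma34Hyp (k : ℕ) (ω : ℝ) : Prop :=
  ∀ (n r j : ℕ) (Δ C : ℝ), 1 ≤ n → n * k ≤ k ^ 3 → 4 ≤ r → r ≤ k → 2 ≤ j → 10 * j ≤ 9 * r →
    ((j : ℝ) - 1) * ((j : ℝ) - 2) ≤ 2 * Δ - ((k : ℝ) - r) * ((k : ℝ) - r + 1) →
    (∀ J : ℕ, 1 ≤ J → J ≤ j → 1 / ((k : ℝ) + 1) ≤ phiF k r Δ j J) →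
    (∀ Q : ℕ, 1 ≤ Q → (VMV.J k (n * k) (Finset.Icc (1 : ℤ) Q) : ℝ) ≤ C * (Q : ℝ) ^ expo k n Δ) →
    ∀ P : ℕ, Vf k ω ^ (k + 1) ≤ (P : ℝ) →
      (VMV.J k ((n + 1) * k) (Finset.Icc (1 : ℤ) P) : ℝ) ≤
        (k : ℝ) ^ (3 * k) * (1 + ω) ^ (4 * (n * k) + k ^ 2) * C * (P : ℝ) ^ expo k (n + 1) (dnext k r Δ j)

/-- `expo k (n+1) x = expo k n x' + 2k + (x − x')`. [folklore] -/
theorem expo_succ (k n : ℕ) (x x' : ℝ) : expo k (n + 1) x = expo k n x' + 2 * k + (x - x') := by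
  unfold expo; push_cast; ring

end FordP1
end Literature.NumberTheory.LFunctions
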